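import Literature.Computability.AlgebraicComplexity.BI17BinaryCubicPolystableProofs
import Literature.Computability.AlgebraicComplexity.BI17PowerSumStabilizerProofs
import Literature.Computability.AlgebraicComplexity.BI17GenericBinaryQuarticPeriodProofs
import HarnessLib

/-!
# Bürgisser–Ikenmeyer 2017, App. Prop. 7.4 (1): the generic binary cubic has stabilizer period
# `a(3,2) = 6` and reduced period `a'(3,2) = 2` — proofs, and the discharge of `BI2017_prop_A_4`

Theorem-only companion (cell `val-lit`, row BI2017-A; no definitions, no named facts) of the file of
record `BI17FundamentalInvariantForms.lean`, which types P. Bürgisser, C. Ikenmeyer, *Fundamental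
invariants of orbit closures*, J. Algebra 477 (2017), Appendix (= arXiv §7) Prop. 7.4 as the named
fact `BI2017_prop_A_4`. Its first clause (main.tex L2927–2928, held text p0026:L68): "1. For a
generic `w ∈ Sym³ℂ²` we have `stab(w) ≃ μ_3 ⋊ S_2`. Hence `a(3,2) = 6` and `a'(3,2) = 2`." — typed as
`IsZariskiGeneric 3 (fun f => stabilizerPeriod f = 6 ∧ reducedStabilizerPeriod 3 f = 2)` — is PROVED
here (`BI2017_prop_A_4_part1`); with the sibling files `BI17GenericBinaryQuarticPeriodProofs.lean`
(clause 2, `BI2017_prop_A_4_part2`, `BI2017_prop_A_4_of_part1`) and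
`BI17GenericBinaryFormStabilizerProofs.lean` (clause 3, `BI2017_prop_A_4_part3`) the named fact is
DISCHARGED: `BI2017_prop_A_4_holds`.

## Proof (orbit route; the group isomorphism of the print is not used)

* (§1) The image `det(stab(f)) ≤ k^×` — hence the stabilizer period — is an invariant of the
  `GL`-orbit and of nonzero rescaling: `stab(g · f) = g stab(f) g⁻¹` and `det` is a homomorphism to
  an abelian group; `stab(c f) = stab(f)` for `c ≠ 0` (any index type, any field).
* (§2) A binary cubic `f = a x³ + b x²y + c xy² + d y³` with `a · disc ≠ 0` splits over `ℂ` into three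
  pairwise independent linear forms, so `M · f = c · xy(x+y)` for an invertible `M` and `c ≠ 0`
  (val-lit-p5's `BinaryCubic.exists_linSubst_eq_smul_xyxy`); the Fermat cubic `x³ + y³` has the same
  normal form (`BinaryCubic.exists_linSubst_sum_X_pow_three_eq_smul_xyxy`), and a cube root absorbs
  the ratio of the scalars: `f ∈ GL₂ · (x³ + y³)` (`BinaryCubic.exists_eq_linSubst_sum_X_pow_three`,
  the orbit statement implicit in `BinaryCubic.isPolystable_binaryCubic`).
* (§3) Hence `a(f) = a(x³ + y³) = 2 · 3 = 6` by BI 2017 Prop. 2.4(2) (`stabilizerPeriod_psum`), and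
  `a'(f) = a(f) · gcd(3,2) / 3 = 2`; the genericity polynomial is `A · Disc(A,B,C,D)` in the four
  coefficients (value `-27` at `x³ + y³`), exactly as in `BI2017_prop_2_10_three_two`.

Honest framing: bookkeeping of a printed statement about binary cubics (classical invariant theory);
nothing here bears on VP versus VNP.

## References

* [BurgisserIkenmeyer2017] P. Bürgisser, C. Ikenmeyer, J. Algebra 477 (2017) 390–434 =
  arXiv:1511.02927, Appendix Prop. 7.4 (1) (main.tex L2925–2934); §2.1 Def. 2.2; Prop. 2.4(2).

## Tree

`linSubst`, `linSubst_mul`, `linSubst_one`, `linSubstRep`, `linSubstRep_apply` (`LinSubst`);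
`linStabilizer`, `mem_linStabilizer` (`EquivariantDC`); `stabilizerDetImage`,
`mem_stabilizerDetImage_iff`, `stabilizerPeriod`, `stabilizerPeriod_def`, `reducedStabilizerPeriod`,
`IsZariskiGeneric`, `BI2017_prop_A_4` (`BI17FundamentalInvariantForms`);
`linSubst_smul_of_isHomogeneous` (`PolystabilityProofs`); `stabilizerPeriod_psum`
(`BI17PowerSumStabilizerProofs`); `BinaryCubic.exists_linSubst_eq_smul_xyxy`,
`BinaryCubic.exists_linSubst_sum_X_pow_three_eq_smul_xyxy` (`BI17BinaryCubicPolystableProofs`);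
`BI2017_prop_A_4_of_part1` (`BI17GenericBinaryQuarticPeriodProofs`). Mathlib: `IsAlgClosed.splits`,
`Polynomial.splits_iff_card_roots`, `Multiset.card_eq_three`, `IsAlgClosed.exists_pow_nat_eq`,
`Matrix.GeneralLinearGroup.mkOfDetNeZero`.
-/

noncomputable section

open MvPolynomial

namespace Literature.Computability.AlgebraicComplexity

/-! ### §1 The stabilizer period is an invariant of `GL`-orbits and of nonzero rescaling -/

section OrbitInvariance

variable {σ k : Type*} [Fintype σ] [DecidableEq σ] [Field k]

/-- **Conjugate stabilizers**: `γ ∈ stab(g · f) ↔ g⁻¹ γ g ∈ stab(f)` (BI 2017 §2.1: the stabilizer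
period "depends only on the orbit"). [cite: BurgisserIkenmeyer2017, §2.1 (Def. 2.2)] -/
theorem mem_linStabilizer_linSubstRep_iff (g γ : GL σ k) (f : MvPolynomial σ k) :
    γ ∈ linStabilizer (linSubstRep σ k g f) ↔ g⁻¹ * γ * g ∈ linStabilizer f := by
  simp only [mem_linStabilizer, map_mul, Module.End.mul_apply]
  constructor
  · intro h
    rw [h, ← Module.End.mul_apply, ← map_mul, inv_mul_cancel, map_one, Module.End.one_apply]
  · intro h
    have h' := congrArg (linSubstRep σ k g) h
    rw [← Module.End.mul_apply, ← Module.End.mul_apply, ← map_mul, ← map_mul, mul_inv_cancel,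
      one_mul] at h'
    exact h'

/-- **`det(stab(g · f)) = det(stab(f))`**: the image of the stabilizer under `det` is an invariant of
the `GL`-orbit (conjugate subgroups, `det` a homomorphism to the abelian group `k^×`).
[cite: BurgisserIkenmeyer2017, §2.1 (Def. 2.2)] -/
theorem stabilizerDetImage_linSubstRep (g : GL σ k) (f : MvPolynomial σ k) :
    stabilizerDetImage (linSubstRep σ k g f) = stabilizerDetImage f := by
  ext u
  simp only [mem_stabilizerDetImage_iff]
  constructor
  · rintro ⟨γ, hγ, rfl⟩
    refine ⟨g⁻¹ * γ * g, (mem_linStabilizer_linSubstRep_iff g γ f).mp hγ, ?_⟩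
    rw [map_mul, map_mul, map_inv, mul_assoc, mul_comm (Matrix.GeneralLinearGroup.det γ),
      ← mul_assoc, inv_mul_cancel, one_mul]
  · rintro ⟨γ, hγ, rfl⟩
    refine ⟨g * γ * g⁻¹, (mem_linStabilizer_linSubstRep_iff g _ f).mpr ?_, ?_⟩
    · have : g⁻¹ * (g * γ * g⁻¹) * g = γ := by group
      rwa [this]
    · rw [map_mul, map_mul, map_inv, mul_assoc, mul_comm (Matrix.GeneralLinearGroup.det γ),
        ← mul_assoc, mul_inv_cancel, one_mul]

/-- **The stabilizer period is constant on `GL`-orbits**: `a(g · f) = a(f)`.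
[cite: BurgisserIkenmeyer2017, §2.1 (Def. 2.2)] -/
theorem stabilizerPeriod_linSubstRep (g : GL σ k) (f : MvPolynomial σ k) :
    stabilizerPeriod (linSubstRep σ k g f) = stabilizerPeriod f := by
  rw [stabilizerPeriod_def, stabilizerPeriod_def, stabilizerDetImage_linSubstRep]

/-- Matrix form of `stabilizerPeriod_linSubstRep`: `a(A · f) = a(f)` for every matrix `A` with
`det A ≠ 0`. [cite: BurgisserIkenmeyer2017, §2.1 (Def. 2.2)] -/
theorem stabilizerPeriod_linSubst_of_det_ne_zero {A : Matrix σ σ k} (hA : A.det ≠ 0)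
    (f : MvPolynomial σ k) : stabilizerPeriod (linSubst σ k A f) = stabilizerPeriod f := by
  have h := stabilizerPeriod_linSubstRep (Matrix.GeneralLinearGroup.mkOfDetNeZero A hA) f
  rwa [linSubstRep_apply] at h

/-- **Rescaling does not change the stabilizer**: `stab(c f) = stab(f)` for `c ≠ 0` (the action is
linear). [cite: BurgisserIkenmeyer2017, §2.1 (Def. 2.2)] -/
theorem linStabilizer_smul {c : k} (hc : c ≠ 0) (f : MvPolynomial σ k) :
    linStabilizer (c • f) = linStabilizer f := by
  ext γ
  simp only [mem_linStabilizer, map_smul]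
  constructor
  · intro h
    have h' := congrArg (fun p : MvPolynomial σ k => c⁻¹ • p) h
    simp only [smul_smul, inv_mul_cancel₀ hc, one_smul] at h'
    exact h'
  · intro h
    rw [h]

/-- `det(stab(c f)) = det(stab(f))` for `c ≠ 0`. [cite: BurgisserIkenmeyer2017, §2.1 (Def. 2.2)] -/
theorem stabilizerDetImage_smul {c : k} (hc : c ≠ 0) (f : MvPolynomial σ k) :
    stabilizerDetImage (c • f) = stabilizerDetImage f := by
  unfold stabilizerDetImage
  rw [linStabilizer_smul hc]

/-- **The stabilizer period is invariant under nonzero rescaling**: `a(c f) = a(f)`, `c ≠ 0`.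
[cite: BurgisserIkenmeyer2017, §2.1 (Def. 2.2)] -/
theorem stabilizerPeriod_smul {c : k} (hc : c ≠ 0) (f : MvPolynomial σ k) :
    stabilizerPeriod (c • f) = stabilizerPeriod f := by
  rw [stabilizerPeriod_def, stabilizerPeriod_def, stabilizerDetImage_smul hc]

end OrbitInvariance

/-! ### §2 A nondegenerate binary cubic lies in the `GL₂`-orbit of `x³ + y³` -/

namespace BinaryCubic

/-- **A binary cubic with `a ≠ 0` splits into linear factors** (public form of the splitting step of
`BI17BinaryCubicPolystableProofs.lean`): `f = a (x − r₁ y)(x − r₂ y)(x − r₃ y)` with Vieta's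
relations `b = −a e₁(r)`, `c = a e₂(r)`, `d = −a e₃(r)` for the coefficients (Mathlib's
`IsAlgClosed.splits` for the dehomogenised cubic `a t³ + b t² + c t + d`).
[cite: BurgisserIkenmeyer2017, §7 (Appendix) Prop. 7.4 (1)] -/
theorem exists_eq_C_mul_prod_linear {f : MvPolynomial (Fin 2) ℂ} (hf : f.IsHomogeneous 3)
    (ha : coeff (Finsupp.single 0 3) f ≠ 0) :
    ∃ r₁ r₂ r₃ : ℂ,
      coeff (Finsupp.single 0 2 + Finsupp.single 1 1) f =
          -(coeff (Finsupp.single 0 3) f * (r₁ + r₂ + r₃)) ∧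
      coeff (Finsupp.single 0 1 + Finsupp.single 1 2) f =
          coeff (Finsupp.single 0 3) f * (r₁ * r₂ + r₁ * r₃ + r₂ * r₃) ∧
      coeff (Finsupp.single 1 3) f = -(coeff (Finsupp.single 0 3) f * (r₁ * r₂ * r₃)) ∧
      f = C (coeff (Finsupp.single 0 3) f) *
        ((X 0 - C r₁ * X 1) * (X 0 - C r₂ * X 1) * (X 0 - C r₃ * X 1)) := by
  classical
  set a := coeff (Finsupp.single 0 3) f with ha'
  set b := coeff (Finsupp.single 0 2 + Finsupp.single 1 1) f with hb'
  set c := coeff (Finsupp.single 0 1 + Finsupp.single 1 2) f with hc'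
  set d := coeff (Finsupp.single 1 3) f with hd'
  -- the dehomogenised cubic and its roots
  set p : Polynomial ℂ := Polynomial.C a * Polynomial.X ^ 3 + Polynomial.C b * Polynomial.X ^ 2 +
    Polynomial.C c * Polynomial.X + Polynomial.C d with hp
  have hdeg : p.natDegree = 3 := Polynomial.natDegree_cubic ha
  have hlead : p.leadingCoeff = a := Polynomial.leadingCoeff_cubic ha
  have hsplit : p.Splits := IsAlgClosed.splits p
  have hcard : p.roots.card = 3 := by rw [Polynomial.splits_iff_card_roots.mp hsplit, hdeg]
  obtain ⟨r₁, r₂, r₃, hroots⟩ := Multiset.card_eq_three.mp hcard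
  have hprod := hsplit.eq_prod_roots
  rw [hlead, hroots] at hprod
  simp only [Multiset.insert_eq_cons, Multiset.map_cons, Multiset.map_singleton, Multiset.prod_cons,
    Multiset.prod_singleton] at hprod
  -- Vieta by comparing coefficients
  have hexp : Polynomial.C a * ((Polynomial.X - Polynomial.C r₁) * ((Polynomial.X - Polynomial.C r₂) *
      (Polynomial.X - Polynomial.C r₃))) =
      Polynomial.C a * Polynomial.X ^ 3 + Polynomial.C (-(a * (r₁ + r₂ + r₃))) * Polynomial.X ^ 2 +
        Polynomial.C (a * (r₁ * r₂ + r₁ * r₃ + r₂ * r₃)) * Polynomial.X +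
        Polynomial.C (-(a * (r₁ * r₂ * r₃))) := by
    simp only [map_neg, map_mul, map_add]
    ring
  rw [hexp, hp] at hprod
  have hcoeff : ∀ (n : ℕ) (a' b' c' d' : ℂ),
      (Polynomial.C a' * Polynomial.X ^ 3 + Polynomial.C b' * Polynomial.X ^ 2 +
        Polynomial.C c' * Polynomial.X + Polynomial.C d').coeff n =
      (if n = 3 then a' else 0) + (if n = 2 then b' else 0) + (if n = 1 then c' else 0) +
        (if n = 0 then d' else 0) := by
    intro n a' b' c' d'
    simp only [Polynomial.coeff_add, Polynomial.coeff_C_mul_X_pow, Polynomial.coeff_C_mul_X,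
      Polynomial.coeff_C]
  have hb : b = -(a * (r₁ + r₂ + r₃)) := by
    have h := congrArg (fun q : Polynomial ℂ => q.coeff 2) hprod
    simp only [hcoeff] at h
    norm_num at h
    exact h
  have hc : c = a * (r₁ * r₂ + r₁ * r₃ + r₂ * r₃) := by
    have h := congrArg (fun q : Polynomial ℂ => q.coeff 1) hprod
    simp only [hcoeff] at h
    norm_num at h
    exact h
  have hd : d = -(a * (r₁ * r₂ * r₃)) := by
    have h := congrArg (fun q : Polynomial ℂ => q.coeff 0) hprod
    simp only [hcoeff] at h
    norm_num at h
    exact h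
  refine ⟨r₁, r₂, r₃, hb, hc, hd, ?_⟩
  -- the identity of binary forms, by comparing the expansions along `x₀^p x₁^{3-p}`
  have hf3 := eq_sum_monomial_binIdx hf
  have hmon : ∀ p : ℕ, p ≤ 3 → monomial (binIdx 3 p).1 (coeff (binIdx 3 p).1 f) =
      C (coeff (binIdx 3 p).1 f) * X 0 ^ p * X 1 ^ (3 - p) := by
    intro p hp
    rw [monomial_eq, Finsupp.prod_fintype _ _ (fun i => pow_zero _), Fin.prod_univ_two,
      binIdx_apply_zero, binIdx_apply_one, min_eq_left hp, mul_assoc]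
  have hidx : ∀ p : ℕ, p ≤ 3 →
      (binIdx 3 p).1 = Finsupp.single 0 p + Finsupp.single 1 (3 - p) := by
    intro p hp
    ext i
    fin_cases i <;> simp [binIdx_apply_zero, binIdx_apply_one, min_eq_left hp]
  simp only [Finset.sum_range_succ, Finset.sum_range_zero, zero_add] at hf3
  rw [hmon 0 (by norm_num), hmon 1 (by norm_num), hmon 2 (by norm_num), hmon 3 le_rfl,
    hidx 0 (by norm_num), hidx 1 (by norm_num), hidx 2 (by norm_num), hidx 3 le_rfl] at hf3
  simp only [Finsupp.single_zero, zero_add, add_zero, Nat.sub_zero, Nat.sub_self, pow_zero, mul_one,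
    show (3 : ℕ) - 1 = 2 from rfl, show (3 : ℕ) - 2 = 1 from rfl] at hf3
  rw [← ha', ← hb', ← hc', ← hd'] at hf3
  rw [hf3, hb, hc, hd]
  simp only [map_neg, map_mul, map_add]
  ring

/-- **A nondegenerate binary cubic is `GL₂`-equivalent to the Fermat cubic**: if `a ≠ 0` and
`disc = b²c² − 4ac³ − 4b³d − 27a²d² + 18abcd ≠ 0` then `f = A · (x³ + y³)` for an invertible `A`
(both sides have the normal form `c · xy(x+y)`, `c ≠ 0`, and a cube root absorbs the scalar) — the
orbit statement behind `isPolystable_binaryCubic`, made explicit.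
[cite: BurgisserIkenmeyer2017, §7 (Appendix) Prop. 7.4 (1)] -/
theorem exists_eq_linSubst_sum_X_pow_three {f : MvPolynomial (Fin 2) ℂ} (hf : f.IsHomogeneous 3)
    (ha : coeff (Finsupp.single 0 3) f ≠ 0)
    (hdisc : coeff (Finsupp.single 0 2 + Finsupp.single 1 1) f ^ 2 *
          coeff (Finsupp.single 0 1 + Finsupp.single 1 2) f ^ 2 -
        4 * coeff (Finsupp.single 0 3) f * coeff (Finsupp.single 0 1 + Finsupp.single 1 2) f ^ 3 -
        4 * coeff (Finsupp.single 0 2 + Finsupp.single 1 1) f ^ 3 * coeff (Finsupp.single 1 3) f -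
        27 * coeff (Finsupp.single 0 3) f ^ 2 * coeff (Finsupp.single 1 3) f ^ 2 +
        18 * coeff (Finsupp.single 0 3) f * coeff (Finsupp.single 0 2 + Finsupp.single 1 1) f *
          coeff (Finsupp.single 0 1 + Finsupp.single 1 2) f * coeff (Finsupp.single 1 3) f ≠ 0) :
    ∃ A : Matrix (Fin 2) (Fin 2) ℂ, A.det ≠ 0 ∧
      f = linSubst (Fin 2) ℂ A (∑ i : Fin 2, (X i : MvPolynomial (Fin 2) ℂ) ^ 3) := by
  obtain ⟨r₁, r₂, r₃, hb, hc, hd, hfeq⟩ := exists_eq_C_mul_prod_linear hf ha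
  set a := coeff (Finsupp.single 0 3) f with ha'
  have hdisc' : a ^ 4 * ((r₁ - r₂) * (r₁ - r₃) * (r₂ - r₃)) ^ 2 ≠ 0 := by
    intro h0
    apply hdisc
    rw [hb, hc, hd]
    linear_combination h0
  have hprod : (r₁ - r₂) * (r₁ - r₃) * (r₂ - r₃) ≠ 0 := by
    intro h
    apply hdisc'
    rw [h, zero_pow two_ne_zero, mul_zero]
  have h12 : r₁ ≠ r₂ := fun h => hprod (by rw [h, sub_self, zero_mul, zero_mul])
  have h13 : r₁ ≠ r₃ := fun h => hprod (by rw [h, sub_self, mul_zero, zero_mul])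
  have h23 : r₂ ≠ r₃ := fun h => hprod (by rw [h, sub_self, mul_zero])
  obtain ⟨M, hM, c, hc0, hMf⟩ := exists_linSubst_eq_smul_xyxy ha h12 h13 h23 hfeq
  obtain ⟨M₀, hM₀, c₀, hc₀, hM₀f⟩ := exists_linSubst_sum_X_pow_three_eq_smul_xyxy
  -- a cube root absorbs the ratio of the two scalars
  obtain ⟨μ, hμ⟩ := IsAlgClosed.exists_pow_nat_eq (c / c₀) (by norm_num : 0 < 3)
  have hμ0 : μ ≠ 0 := by
    rintro rfl
    rw [zero_pow three_ne_zero] at hμ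
    exact div_ne_zero hc0 hc₀ hμ.symm
  have hsum : (∑ i : Fin 2, X i ^ 3 : MvPolynomial (Fin 2) ℂ).IsHomogeneous 3 :=
    IsHomogeneous.sum _ _ _ fun i _ => isHomogeneous_X_pow i 3
  have key : linSubst (Fin 2) ℂ (μ • M₀) (∑ i : Fin 2, X i ^ 3) = linSubst (Fin 2) ℂ M f := by
    rw [linSubst_smul_of_isHomogeneous hsum, hM₀f, hMf, smul_smul, hμ, div_mul_cancel₀ c hc₀]
  have hMinv : M⁻¹ * M = 1 := Matrix.nonsing_inv_mul M (isUnit_iff_ne_zero.mpr hM)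
  refine ⟨M⁻¹ * (μ • M₀), ?_, ?_⟩
  · rw [Matrix.det_mul, Matrix.det_smul, Fintype.card_fin]
    refine mul_ne_zero ?_ (mul_ne_zero (pow_ne_zero 2 hμ0) hM₀)
    rw [Matrix.det_nonsing_inv, Ring.inverse_eq_inv']
    exact inv_ne_zero hM
  · rw [linSubst_mul, AlgHom.comp_apply, key, ← AlgHom.comp_apply, ← linSubst_mul, hMinv,
      linSubst_one, AlgHom.id_apply]

/-- **The stabilizer period of a nondegenerate binary cubic is `6`** (`a ≠ 0`, `disc ≠ 0`): it lies
in the `GL₂`-orbit of `x³ + y³`, whose period is `2 · 3` (BI 2017 Prop. 2.4(2),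
`stabilizerPeriod_psum`), and the period is constant on orbits.
[cite: BurgisserIkenmeyer2017, §7 (Appendix) Prop. 7.4 (1)] -/
theorem stabilizerPeriod_eq_six {f : MvPolynomial (Fin 2) ℂ} (hf : f.IsHomogeneous 3)
    (ha : coeff (Finsupp.single 0 3) f ≠ 0)
    (hdisc : coeff (Finsupp.single 0 2 + Finsupp.single 1 1) f ^ 2 *
          coeff (Finsupp.single 0 1 + Finsupp.single 1 2) f ^ 2 -
        4 * coeff (Finsupp.single 0 3) f * coeff (Finsupp.single 0 1 + Finsupp.single 1 2) f ^ 3 -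
        4 * coeff (Finsupp.single 0 2 + Finsupp.single 1 1) f ^ 3 * coeff (Finsupp.single 1 3) f -
        27 * coeff (Finsupp.single 0 3) f ^ 2 * coeff (Finsupp.single 1 3) f ^ 2 +
        18 * coeff (Finsupp.single 0 3) f * coeff (Finsupp.single 0 2 + Finsupp.single 1 1) f *
          coeff (Finsupp.single 0 1 + Finsupp.single 1 2) f * coeff (Finsupp.single 1 3) f ≠ 0) :
    stabilizerPeriod f = 6 := by
  obtain ⟨A, hA, hfA⟩ := exists_eq_linSubst_sum_X_pow_three hf ha hdisc
  rw [hfA, stabilizerPeriod_linSubst_of_det_ne_zero hA,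
    stabilizerPeriod_psum (m := 2) (by norm_num : 2 < 3) (by norm_num : 1 < 2)]
  have h3 : ¬ Even 3 := by decide
  rw [if_neg h3]

end BinaryCubic

/-! ### §3 BI 2017 App. Prop. 7.4 (1), and the discharge of `BI2017_prop_A_4` -/

section Main

open BinaryCubic

/-- **BI 2017, Appendix Prop. 7.4 (1), PROVED** (main.tex L2927–2928, held text p0026:L68): "1. For
a generic `w ∈ Sym³ℂ²` … `a(3,2) = 6` and `a'(3,2) = 2`": for Zariski-generic binary cubics `f` (off
`{A · Disc = 0}`, `A` the coefficient of `x³`, `Disc` the discriminant in the four coefficients),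
`stabilizerPeriod f = 6` and `reducedStabilizerPeriod 3 f = 6 · gcd(3,2) / 3 = 2`. The printed group
isomorphism `stab(w) ≃ μ_3 ⋊ S_2` (modulo scalars) is not typed and not used.
[cite: BurgisserIkenmeyer2017, §7 (Appendix) Prop. 7.4 (1)] -/
theorem BI2017_prop_A_4_part1 :
    IsZariskiGeneric 3 (fun f : MvPolynomial (Fin 2) ℂ =>
      stabilizerPeriod f = 6 ∧ reducedStabilizerPeriod 3 f = 2) := by
  have hA : (Finsupp.single 0 3 : Fin 2 →₀ ℕ) ∈ degMonomials (Fin 2) 3 := by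
    rw [mem_degMonomials_iff, Finsupp.degree_single]
  have hB : (Finsupp.single 0 2 + Finsupp.single 1 1 : Fin 2 →₀ ℕ) ∈ degMonomials (Fin 2) 3 := by
    rw [mem_degMonomials_iff, map_add, Finsupp.degree_single, Finsupp.degree_single]
  have hC : (Finsupp.single 0 1 + Finsupp.single 1 2 : Fin 2 →₀ ℕ) ∈ degMonomials (Fin 2) 3 := by
    rw [mem_degMonomials_iff, map_add, Finsupp.degree_single, Finsupp.degree_single]
  have hD : (Finsupp.single 1 3 : Fin 2 →₀ ℕ) ∈ degMonomials (Fin 2) 3 := by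
    rw [mem_degMonomials_iff, Finsupp.degree_single]
  set A : MvPolynomial (DegIdx (Fin 2) 3) ℂ := X ⟨_, hA⟩ with hAdef
  set B : MvPolynomial (DegIdx (Fin 2) 3) ℂ := X ⟨_, hB⟩ with hBdef
  set Cc : MvPolynomial (DegIdx (Fin 2) 3) ℂ := X ⟨_, hC⟩ with hCdef
  set Dd : MvPolynomial (DegIdx (Fin 2) 3) ℂ := X ⟨_, hD⟩ with hDdef
  -- the values of the four coordinates at a form `f`
  have hval : ∀ f : MvPolynomial (Fin 2) ℂ,
      aeval (formCoeff 3 f) A = coeff (Finsupp.single 0 3) f ∧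
      aeval (formCoeff 3 f) B = coeff (Finsupp.single 0 2 + Finsupp.single 1 1) f ∧
      aeval (formCoeff 3 f) Cc = coeff (Finsupp.single 0 1 + Finsupp.single 1 2) f ∧
      aeval (formCoeff 3 f) Dd = coeff (Finsupp.single 1 3) f := fun f => by
    refine ⟨?_, ?_, ?_, ?_⟩ <;> simp only [hAdef, hBdef, hCdef, hDdef, aeval_X, formCoeff_apply]
  refine ⟨A * (B ^ 2 * Cc ^ 2 - 4 * A * Cc ^ 3 - 4 * B ^ 3 * Dd - 27 * A ^ 2 * Dd ^ 2 +
    18 * A * B * Cc * Dd), ?_, fun f hf hF => ?_⟩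
  · -- nonzero: value `-27` at the Fermat cubic
    intro h
    set f₀ : MvPolynomial (Fin 2) ℂ := X 0 ^ 3 + X 1 ^ 3 with hf₀
    have h03 : (Finsupp.single 1 3 : Fin 2 →₀ ℕ) ≠ Finsupp.single 0 3 :=
      fun h => by have := congrArg (fun e : Fin 2 →₀ ℕ => e 0) h; simp at this
    have h0B : (Finsupp.single 0 3 : Fin 2 →₀ ℕ) ≠ Finsupp.single 0 2 + Finsupp.single 1 1 :=
      fun h => by have := congrArg (fun e : Fin 2 →₀ ℕ => e 0) h; simp at this
    have h1B : (Finsupp.single 1 3 : Fin 2 →₀ ℕ) ≠ Finsupp.single 0 2 + Finsupp.single 1 1 :=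
      fun h => by have := congrArg (fun e : Fin 2 →₀ ℕ => e 0) h; simp at this
    have h0C : (Finsupp.single 0 3 : Fin 2 →₀ ℕ) ≠ Finsupp.single 0 1 + Finsupp.single 1 2 :=
      fun h => by have := congrArg (fun e : Fin 2 →₀ ℕ => e 0) h; simp at this
    have h1C : (Finsupp.single 1 3 : Fin 2 →₀ ℕ) ≠ Finsupp.single 0 1 + Finsupp.single 1 2 :=
      fun h => by have := congrArg (fun e : Fin 2 →₀ ℕ => e 0) h; simp at this
    have h30 : (Finsupp.single 0 3 : Fin 2 →₀ ℕ) ≠ Finsupp.single 1 3 := fun h => h03 h.symm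
    have ca : coeff (Finsupp.single 0 3) f₀ = 1 := by
      rw [hf₀, coeff_add, coeff_X_pow, coeff_X_pow, if_pos rfl, if_neg h03, add_zero]
    have cb : coeff (Finsupp.single 0 2 + Finsupp.single 1 1) f₀ = 0 := by
      rw [hf₀, coeff_add, coeff_X_pow, coeff_X_pow, if_neg h0B, if_neg h1B, add_zero]
    have cc : coeff (Finsupp.single 0 1 + Finsupp.single 1 2) f₀ = 0 := by
      rw [hf₀, coeff_add, coeff_X_pow, coeff_X_pow, if_neg h0C, if_neg h1C, add_zero]
    have cd : coeff (Finsupp.single 1 3) f₀ = 1 := by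
      rw [hf₀, coeff_add, coeff_X_pow, coeff_X_pow, if_neg h30, if_pos rfl, zero_add]
    obtain ⟨vA, vB, vC, vD⟩ := hval f₀
    have := congrArg (aeval (formCoeff 3 f₀)) h
    simp only [map_mul, map_sub, map_add, map_pow, vA, vB, vC, vD, ca, cb, cc, cd, map_ofNat,
      map_zero] at this
    norm_num at this
  · obtain ⟨vA, vB, vC, vD⟩ := hval f
    simp only [map_mul, map_sub, map_add, map_pow, vA, vB, vC, vD, map_ofNat] at hF
    have ha : coeff (Finsupp.single 0 3) f ≠ 0 := by
      intro h0
      apply hF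
      rw [h0, zero_mul]
    have hdisc := right_ne_zero_of_mul hF
    have hper : stabilizerPeriod f = 6 := stabilizerPeriod_eq_six hf ha hdisc
    refine ⟨hper, ?_⟩
    rw [reducedStabilizerPeriod, hper, Fintype.card_fin]
    decide

/-- **BI 2017, Appendix Prop. 7.4 (binary forms) — the named fact `BI2017_prop_A_4` holds**: clause 1
(`a(3,2) = 6`, `a'(3,2) = 2`, this file), clause 2 (`a(4,2) = 2`, `a'(4,2) = 1`,
`BI2017_prop_A_4_part2`) and clause 3 (`D ≥ 5`: trivial generic stabilizer, `a'(D,2) = 1`,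
`BI2017_prop_A_4_part3`), assembled by `BI2017_prop_A_4_of_part1`.
[cite: BurgisserIkenmeyer2017, §7 (Appendix) Prop. 7.4] -/
theorem BI2017_prop_A_4_holds : BI2017_prop_A_4 :=
  BI2017_prop_A_4_of_part1 BI2017_prop_A_4_part1

end Main

end Literature.Computability.AlgebraicComplexity

end
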